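import Summits.ResolutionOfSingularities.ResolutionOfSingularities.Theorems.PurelyInseparableDim4ResConeShadeTwoStep
import Summits.ResolutionOfSingularities.ResolutionOfSingularities.Theorems.PurelyInseparableDim4FreeTail
import Mathlib.Algebra.Order.Antidiag.Finsupp
import HarnessLib
import HarnessLib.Audit.Tags

/-!
# Purely inseparable four-folds — K2(p), PHASE `d = 2`, PART II: bookkeeping of an ALL-CORNER shade-`2` chain (every
# prime; idea-4 «QUADRATIC ABSORPTION» I-4-4 (Q1)(ii)/(Q4))

[OURS · counted 0 · cell `res-dim4-pi` · seat res-dim4-p-7 g3 · K2(p) lane (holder res-dim4-p-12 lineage; desk WORD #82 (c));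
hand analysis res-dim4-idea-4 (cards I-4-4 / I-4-5).]  Nothing here proves K2(p), `NoIsolatedTrap p p`, or resolution of
singularities in dimension ≥ 4 / characteristic `p`.  AI kernel work, weaker than expert review.

Along a witnessed `Step0 p` chain of isolated states off the floor, of constant shade `2`, with `x^{r₀} ∣ F₀` and all steps
CORNER steps (`b_k = 0`):
* §0 exponent helpers on four letters;
* §1 `corner_step` (`r_{k+1} = r_k.update j_k (W_k + 2 − p)`, `W_{k+1} + r_k(j_k) + p = 2W_k + 2`), `corner_quadric` (the quadric
  only absorbs: `supp g_k ⊆ supp g_{k+1}`, `g_k` is `x_{j_k}`-free, `coeff_μ g_{k+1} = coeff_{r_k+μ+μ_j e_j} F_k`),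
  `support_resForm_eventually_const`, `no_birth` (no `x^{r+2e_j+e_a}`, `x^{r+4e_j}` once the support is stable), `no_cube`,
  `corner_source` (backward transport `m′ = m.update j (|m| − 2)`), `exists_axis_witness` (legality above the boundary).
Sequels: `…ResConeShadeTwoLedger` (the ledger freezes; endgame lemmas), `…ResConeShadeTwoNoCornerTrap` (the theorem).
bears_on: LADDER-RESOLUTION:D157-DOOR2 (res-dim4-pi · K2(p) · phase d = 2).  Supports stmt-ResolutionOfSingularities-16155
(helper).
-/

set_option linter.dupNamespace false -- mandated namespace of this single-conjunct summit

noncomputable section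

namespace Summit.ResolutionOfSingularities.ResolutionOfSingularities.Theorems.PIDim4

namespace ResCone

open MvPolynomial Finset
open Literature.AlgebraicGeometry.Resolution
open Literature.AlgebraicGeometry.Resolution.CentreBlowup
open Literature.AlgebraicGeometry.Resolution.Hauser2010
open Literature.AlgebraicGeometry.Resolution.HauserPerlega2019

variable {K : Type} [Field K] [DecidableEq K]

/-! ## §0 Exponent helpers on four letters -/

section Exponents

/-- Two coordinates are bounded by the degree. [folklore] -/
theorem apply_add_apply_le_degree (m : Fin 4 →₀ ℕ) {a c : Fin 4} (hac : a ≠ c) : m a + m c ≤ m.degree := by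
  rw [Finsupp.degree_eq_sum, ← Finset.add_sum_erase _ _ (Finset.mem_univ a),
    ← Finset.add_sum_erase _ _ (Finset.mem_erase.mpr ⟨hac.symm, Finset.mem_univ c⟩)]
  omega

/-- If two coordinates exhaust the degree, the others vanish. [folklore] -/
theorem apply_eq_zero_of_degree_eq (m : Fin 4 →₀ ℕ) {a c : Fin 4} (hac : a ≠ c) (h : m.degree = m a + m c)
    (i : Fin 4) (hia : i ≠ a) (hic : i ≠ c) : m i = 0 := by
  rw [Finsupp.degree_eq_sum, ← Finset.add_sum_erase _ _ (Finset.mem_univ a),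
    ← Finset.add_sum_erase _ _ (Finset.mem_erase.mpr ⟨hac.symm, Finset.mem_univ c⟩)] at h
  have hz : ∑ x ∈ ((Finset.univ : Finset (Fin 4)).erase a).erase c, m x = 0 := by omega
  exact Finset.sum_eq_zero_iff.mp hz i (Finset.mem_erase.mpr ⟨hic, Finset.mem_erase.mpr ⟨hia, Finset.mem_univ i⟩⟩)

/-- An exponent vanishing off two letters is a sum of two singles. [folklore] -/
theorem eq_single_add_single_of_forall (m : Fin 4 →₀ ℕ) {a c : Fin 4} (hac : a ≠ c)
    (h : ∀ i, i ≠ a → i ≠ c → m i = 0) : m = Finsupp.single a (m a) + Finsupp.single c (m c) := by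
  ext i
  rw [Finsupp.add_apply, Finsupp.single_apply, Finsupp.single_apply]
  by_cases hia : i = a
  · subst hia; rw [if_pos rfl, if_neg (fun h => hac h.symm), add_zero]
  · by_cases hic : i = c
    · subst hic; rw [if_neg (fun h => hia h.symm), if_pos rfl, zero_add]
    · rw [if_neg (fun h => hia h.symm), if_neg (fun h => hic h.symm), add_zero]; exact h i hia hic

/-- An exponent vanishing off one letter is a single. [folklore] -/
theorem eq_single_of_forall (m : Fin 4 →₀ ℕ) {a : Fin 4} (h : ∀ i, i ≠ a → m i = 0) :
    m = Finsupp.single a (m a) := by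
  ext i
  rw [Finsupp.single_apply]
  by_cases hia : i = a
  · subst hia; rw [if_pos rfl]
  · rw [if_neg (fun h => hia h.symm)]; exact h i hia

/-- Degree of an update: `|m.update i v| + m_i = |m| + v`. [folklore] -/
theorem degree_update_add (m : Fin 4 →₀ ℕ) (i : Fin 4) (v : ℕ) : (m.update i v).degree + m i = m.degree + v := by
  rw [Finsupp.degree_eq_sum, Finsupp.degree_eq_sum, Finsupp.coe_update,
    Finset.sum_update_of_mem (Finset.mem_univ i), Finset.sdiff_singleton_eq_erase,
    ← Finset.add_sum_erase _ (⇑m) (Finset.mem_univ i)]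
  omega

/-- Reading the coordinates of an updated exponent. [folklore] -/
theorem apply_of_eq_update {m m' : Fin 4 →₀ ℕ} {a : Fin 4} {v : ℕ} (h : m' = m.update a v) :
    m' a = v ∧ ∀ i, i ≠ a → m' i = m i := by
  subst h
  exact ⟨by rw [Finsupp.update_apply, if_pos rfl], fun i hi => by rw [Finsupp.update_apply, if_neg hi]⟩

end Exponents

/-! ## §1 Bookkeeping of an all-corner shade-`2` chain -/

section Corner

variable {p : ℕ} [hp : Fact p.Prime] {c : ℕ → State K} {j : ℕ → Fin 4} {b : ℕ → Fin 4 → K}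

omit hp in
/-- A witnessed chain is a `Step0` chain. [folklore] -/
theorem step0_of_isWitnessedChain (hw : FreeTail.IsWitnessedChain p c j b) (k : ℕ) : Step0 p (c k) (c (k + 1)) := by
  obtain ⟨hq, hbk, heq, hne, hck⟩ := hw k
  exact ⟨hq, j k, b k, Finset.mem_univ _, hbk, heq, hne, hck⟩

/-- **One corner step of the chain**: `c (k+1) = step p univ (j k) 0 (c k)`, `r_{k+1} = r_k.update (j k) (W_k + 2 − p)`,
`W_{k+1} + r_k(j k) + p = 2 W_k + 2`, and the shade is kept. [OURS · K2(p) phase d = 2] [folklore] -/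
theorem corner_step (hw : FreeTail.IsWitnessedChain p c j b)
    (hc : ∀ k, IsIsolated p (c k).F ∧ Step0 p (c k) (c (k + 1)) ∧ ordZero (c k).F ≠ p ∧ (c k).shade = 2)
    (hr0 : ∀ e ∈ (c 0).F.support, (c 0).r ≤ e) (hb : ∀ k, b k = 0) (k : ℕ) :
    c (k + 1) = CentreBlowup.step p Finset.univ (j k) (0 : Fin 4 → K) (c k) ∧
      (c (k + 1)).r = (c k).r.update (j k) ((c k).r.degree + 2 - p) ∧
      (c (k + 1)).r.degree + (c k).r (j k) + p = 2 * (c k).r.degree + 2 ∧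
      (CentreBlowup.step p Finset.univ (j k) (0 : Fin 4 → K) (c k)).shade = (c k).shade := by
  have hr : ∀ e ∈ (c k).F.support, (c k).r ≤ e :=
    IsolatedBand.isolated_chain_forall_le (fun k => ⟨(hc k).1, (hc k).2.1⟩) hr0 k
  obtain ⟨ho, hpW, -⟩ := shadeTwo_letters p hc hr0 k
  obtain ⟨-, -, -, -, hck⟩ := hw k
  rw [hb k] at hck
  have hr' : (c (k + 1)).r = (c k).r.update (j k) ((c k).r.degree + 2 - p) := by
    rw [hck, shadeTwo_step_r (j k) rfl (c k) ho hr]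
    congr 1
    ext i
    rw [Finsupp.filter_apply, if_pos (Pi.zero_apply _)]
  have hdeg : (c (k + 1)).r.degree + (c k).r (j k) + p = 2 * (c k).r.degree + 2 := by
    have h := shadeTwo_step_degree_of_corner (p := p) (j k) (0 : Fin 4 → K) (c k) rfl ho (by omega)
      (fun i => Or.inl rfl)
    rw [← hck] at h
    exact h
  have heq : (CentreBlowup.step p Finset.univ (j k) (0 : Fin 4 → K) (c k)).shade = (c k).shade := by
    rw [← hck, (hc (k + 1)).2.2.2, (hc k).2.2.2]
  exact ⟨hck, hr', hdeg, heq⟩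

/-- **The quadric only absorbs**: `supp g_k ⊆ supp g_{k+1}`, every monomial of `g_k` avoids the chart letter `j k`, and for
`|μ| = 2`: `coeff_μ g_{k+1} = coeff_{r_k + μ + μ_{j k} e_{j k}} F_k`. [OURS · K2(p) phase d = 2] [folklore] -/
theorem corner_quadric (hw : FreeTail.IsWitnessedChain p c j b)
    (hc : ∀ k, IsIsolated p (c k).F ∧ Step0 p (c k) (c (k + 1)) ∧ ordZero (c k).F ≠ p ∧ (c k).shade = 2)
    (hr0 : ∀ e ∈ (c 0).F.support, (c 0).r ≤ e) (hb : ∀ k, b k = 0) (k : ℕ) :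
    (resForm (c k)).support ⊆ (resForm (c (k + 1))).support ∧
      (∀ μ ∈ (resForm (c k)).support, μ (j k) = 0) ∧
      ∀ μ : Fin 4 →₀ ℕ, μ.degree = 2 →
        coeff μ (resForm (c (k + 1))) = coeff ((c k).r + μ + Finsupp.single (j k) (μ (j k))) (c k).F := by
  have hp2 : 2 ≤ p := hp.out.two_le
  have hc2 : ∀ k, IsIsolated p (c k).F ∧ Step0 p (c k) (c (k + 1)) := fun k => ⟨(hc k).1, (hc k).2.1⟩
  have hr : ∀ e ∈ (c k).F.support, (c k).r ≤ e := IsolatedBand.isolated_chain_forall_le hc2 hr0 k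
  have hr1 : ∀ e ∈ (c (k + 1)).F.support, (c (k + 1)).r ≤ e := IsolatedBand.isolated_chain_forall_le hc2 hr0 (k + 1)
  obtain ⟨ho, hpW, hW2⟩ := shadeTwo_letters p hc hr0 k
  obtain ⟨-, hpW1, hW21⟩ := shadeTwo_letters p hc hr0 (k + 1)
  obtain ⟨hck, -, -, heq⟩ := corner_step hw hc hr0 hb k
  have hiso' : IsIsolated p (CentreBlowup.step p Finset.univ (j k) (0 : Fin 4 → K) (c k)).F := by
    rw [← hck]; exact (hc (k + 1)).1
  have hr1' : ∀ e ∈ (CentreBlowup.step p Finset.univ (j k) (0 : Fin 4 → K) (c k)).F.support,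
      (CentreBlowup.step p Finset.univ (j k) (0 : Fin 4 → K) (c k)).r ≤ e := by
    rw [← hck]; exact hr1
  have hpW1' : p ≤ (CentreBlowup.step p Finset.univ (j k) (0 : Fin 4 → K) (c k)).r.degree + 1 := by
    rw [← hck]; exact hpW1
  have hW21' : (CentreBlowup.step p Finset.univ (j k) (0 : Fin 4 → K) (c k)).r.degree + 4 ≤ 2 * p := by
    rw [← hck]; exact hW21
  refine ⟨?_, ?_, ?_⟩
  · have h := support_resForm_subset_of_shadeTwo hp2 (j k) rfl ho hr hpW hW2 heq hiso' hr1' hpW1' hW21'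
    rwa [← hck] at h
  · intro μ hμ
    have hfree := shear_resForm_free_of_shade_eq (j k) (show (0 : Fin 4 → K) (j k) = 0 from rfl) ho hr
      (by omega) (by omega) heq
    rw [shear_zero] at hfree
    exact hfree μ hμ
  · intro μ hμ
    have h := coeff_resForm_step_zero_of_shadeTwo hp2 (j k) rfl ho hr hpW heq hiso' hr1' hpW1' hW21' hμ
    rwa [← hck] at h

/-- `x^{r_k + μ} ∈ supp F_k ⟺ μ ∈ supp g_k` for `|μ| = 2`. [folklore] -/
theorem mem_support_resForm_iff
    (hc : ∀ k, IsIsolated p (c k).F ∧ Step0 p (c k) (c (k + 1)) ∧ ordZero (c k).F ≠ p ∧ (c k).shade = 2)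
    (hr0 : ∀ e ∈ (c 0).F.support, (c 0).r ≤ e) (k : ℕ) {μ : Fin 4 →₀ ℕ} (hμ : μ.degree = 2) :
    μ ∈ (resForm (c k)).support ↔ (c k).r + μ ∈ (c k).F.support := by
  have hc2 : ∀ k, IsIsolated p (c k).F ∧ Step0 p (c k) (c (k + 1)) := fun k => ⟨(hc k).1, (hc k).2.1⟩
  obtain ⟨ho, -, -⟩ := shadeTwo_letters p hc hr0 k
  rw [MvPolynomial.mem_support_iff, MvPolynomial.mem_support_iff,
    coeff_resForm_eq_coeff_add ho (by rw [hμ]; omega) (by omega)]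

/-- **The support of the quadric is eventually constant** (a monotone sequence of subsets of the finite set of degree-2
exponents). [OURS · K2(p) phase d = 2] [folklore] -/
theorem support_resForm_eventually_const (hw : FreeTail.IsWitnessedChain p c j b)
    (hc : ∀ k, IsIsolated p (c k).F ∧ Step0 p (c k) (c (k + 1)) ∧ ordZero (c k).F ≠ p ∧ (c k).shade = 2)
    (hr0 : ∀ e ∈ (c 0).F.support, (c 0).r ≤ e) (hb : ∀ k, b k = 0) :
    ∃ T : ℕ, ∀ k, T ≤ k → (resForm (c k)).support = (resForm (c T)).support := by
  -- a monotone bounded sequence of naturals is eventually constant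
  have hmono1 : ∀ k, (resForm (c k)).support ⊆ (resForm (c (k + 1))).support :=
    fun k => (corner_quadric hw hc hr0 hb k).1
  have hmono : Monotone fun k => (resForm (c k)).support := monotone_nat_of_le_succ hmono1
  have hbdd : ∀ k, (resForm (c k)).support ⊆ (Finset.univ : Finset (Fin 4)).finsuppAntidiag 2 := by
    intro k μ hμ
    obtain ⟨ho, -, -⟩ := shadeTwo_letters p hc hr0 k
    have h := resForm_isHomogeneous ho (MvPolynomial.mem_support_iff.mp hμ)
    rw [weight_one_eq_degree, Nat.add_sub_cancel_left] at h
    rw [Finset.mem_finsuppAntidiag]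
    exact ⟨by rw [← Finsupp.degree_eq_sum]; exact h, Finset.subset_univ _⟩
  set N := ((Finset.univ : Finset (Fin 4)).finsuppAntidiag 2).card
  have hcard_mono : Monotone fun k => ((resForm (c k)).support).card :=
    fun a b hab => Finset.card_le_card (hmono hab)
  have hcard_bdd : ∀ k, ((resForm (c k)).support).card ≤ N := fun k => Finset.card_le_card (hbdd k)
  -- the cardinality stabilises
  have hstab : ∃ T, ∀ k, T ≤ k → ((resForm (c k)).support).card = ((resForm (c T)).support).card := by
    by_contra h
    push Not at h
    have key : ∀ n, ∃ k, n ≤ ((resForm (c k)).support).card := by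
      intro n
      induction n with
      | zero => exact ⟨0, Nat.zero_le _⟩
      | succ n ih =>
        obtain ⟨k, hk⟩ := ih
        obtain ⟨k', hk', hne⟩ := h k
        exact ⟨k', by have := hcard_mono hk'; simp only at this; omega⟩
    obtain ⟨k, hk⟩ := key (N + 1)
    have := hcard_bdd k
    omega
  obtain ⟨T, hT⟩ := hstab
  refine ⟨T, fun k hk => ?_⟩
  exact (Finset.eq_of_subset_of_card_le (hmono hk) (by rw [hT k hk])).symm

/-- **No births after stabilisation**: if `supp g_{k+1} = supp g_k` then `x^{r_k + 2e_{j k} + e_a} ∉ supp F_k` for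
`a ≠ j k` and `x^{r_k + 4 e_{j k}} ∉ supp F_k`. [OURS · K2(p) phase d = 2] [folklore] -/
theorem no_birth (hw : FreeTail.IsWitnessedChain p c j b)
    (hc : ∀ k, IsIsolated p (c k).F ∧ Step0 p (c k) (c (k + 1)) ∧ ordZero (c k).F ≠ p ∧ (c k).shade = 2)
    (hr0 : ∀ e ∈ (c 0).F.support, (c 0).r ≤ e) (hb : ∀ k, b k = 0) (k : ℕ)
    (hstab : (resForm (c (k + 1))).support = (resForm (c k)).support) :
    (∀ a, a ≠ j k → (c k).r + Finsupp.single (j k) 2 + Finsupp.single a 1 ∉ (c k).F.support) ∧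
      (c k).r + Finsupp.single (j k) 4 ∉ (c k).F.support := by
  obtain ⟨-, hfree, hcoeff⟩ := corner_quadric hw hc hr0 hb k
  have hfree' : ∀ μ ∈ (resForm (c (k + 1))).support, μ (j k) = 0 := by rw [hstab]; exact hfree
  refine ⟨fun a ha hmem => ?_, fun hmem => ?_⟩
  · set μ : Fin 4 →₀ ℕ := Finsupp.single (j k) 1 + Finsupp.single a 1 with hμ
    have hμj : μ (j k) = 1 := by
      rw [hμ, Finsupp.add_apply, Finsupp.single_eq_same, Finsupp.single_apply, if_neg ha, add_zero]
    have hdeg : μ.degree = 2 := by rw [hμ, map_add, Finsupp.degree_single, Finsupp.degree_single]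
    have hsrc : (c k).r + μ + Finsupp.single (j k) (μ (j k)) =
        (c k).r + Finsupp.single (j k) 2 + Finsupp.single a 1 := by
      rw [hμj, hμ]
      ext i
      simp only [Finsupp.add_apply, Finsupp.single_apply]
      split_ifs <;> omega
    have hne : coeff μ (resForm (c (k + 1))) ≠ 0 := by
      rw [hcoeff μ hdeg, hsrc]
      exact MvPolynomial.mem_support_iff.mp hmem
    have := hfree' μ (MvPolynomial.mem_support_iff.mpr hne)
    rw [hμj] at this
    exact one_ne_zero this
  · set μ : Fin 4 →₀ ℕ := Finsupp.single (j k) 2 with hμ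
    have hμj : μ (j k) = 2 := by rw [hμ, Finsupp.single_eq_same]
    have hdeg : μ.degree = 2 := by rw [hμ, Finsupp.degree_single]
    have hsrc : (c k).r + μ + Finsupp.single (j k) (μ (j k)) = (c k).r + Finsupp.single (j k) 4 := by
      rw [hμj, hμ, add_assoc, ← Finsupp.single_add]
    have hne : coeff μ (resForm (c (k + 1))) ≠ 0 := by
      rw [hcoeff μ hdeg, hsrc]
      exact MvPolynomial.mem_support_iff.mp hmem
    have := hfree' μ (MvPolynomial.mem_support_iff.mpr hne)
    rw [hμj] at this
    exact two_ne_zero this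

/-- **No pure cube on the chart letter**: `x^{r_k + 3 e_{j k}} ∉ supp F_k`. [OURS · K2(p) phase d = 2] [folklore] -/
theorem no_cube (hw : FreeTail.IsWitnessedChain p c j b)
    (hc : ∀ k, IsIsolated p (c k).F ∧ Step0 p (c k) (c (k + 1)) ∧ ordZero (c k).F ≠ p ∧ (c k).shade = 2)
    (hr0 : ∀ e ∈ (c 0).F.support, (c 0).r ≤ e) (hb : ∀ k, b k = 0) (k : ℕ) :
    (c k).r + Finsupp.single (j k) 3 ∉ (c k).F.support := by
  have hp2 : 2 ≤ p := hp.out.two_le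
  have hc2 : ∀ k, IsIsolated p (c k).F ∧ Step0 p (c k) (c (k + 1)) := fun k => ⟨(hc k).1, (hc k).2.1⟩
  have hr : ∀ e ∈ (c k).F.support, (c k).r ≤ e := IsolatedBand.isolated_chain_forall_le hc2 hr0 k
  have hr1 : ∀ e ∈ (c (k + 1)).F.support, (c (k + 1)).r ≤ e := IsolatedBand.isolated_chain_forall_le hc2 hr0 (k + 1)
  obtain ⟨ho, hpW, hW2⟩ := shadeTwo_letters p hc hr0 k
  obtain ⟨hck, -, -, heq⟩ := corner_step hw hc hr0 hb k
  have hiso' : IsIsolated p (CentreBlowup.step p Finset.univ (j k) (0 : Fin 4 → K) (c k)).F := by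
    rw [← hck]; exact (hc (k + 1)).1
  have hr1' : ∀ e ∈ (CentreBlowup.step p Finset.univ (j k) (0 : Fin 4 → K) (c k)).F.support,
      (CentreBlowup.step p Finset.univ (j k) (0 : Fin 4 → K) (c k)).r ≤ e := by
    rw [← hck]; exact hr1
  exact not_mem_support_add_three_single hp2 (j k) rfl ho hr hpW hW2 heq hiso' hr1'

/-- **Backward transport** through the corner step `k`: every monomial `x^{r_{k+1} + m′}` of `F_{k+1}` comes from a monomial
`x^{r_k + m}` of `F_k` with `2 ≤ |m|` and `m′ = m.update (j k) (|m| − 2)`. [OURS · K2(p) phase d = 2] [folklore] -/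
theorem corner_source (hw : FreeTail.IsWitnessedChain p c j b)
    (hc : ∀ k, IsIsolated p (c k).F ∧ Step0 p (c k) (c (k + 1)) ∧ ordZero (c k).F ≠ p ∧ (c k).shade = 2)
    (hr0 : ∀ e ∈ (c 0).F.support, (c 0).r ≤ e) (hb : ∀ k, b k = 0) (k : ℕ) {m' : Fin 4 →₀ ℕ}
    (hm' : (c (k + 1)).r + m' ∈ (c (k + 1)).F.support) :
    ∃ m : Fin 4 →₀ ℕ, (c k).r + m ∈ (c k).F.support ∧ 2 ≤ m.degree ∧ m' = m.update (j k) (m.degree - 2) := by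
  have hc2 : ∀ k, IsIsolated p (c k).F ∧ Step0 p (c k) (c (k + 1)) := fun k => ⟨(hc k).1, (hc k).2.1⟩
  have hr : ∀ e ∈ (c k).F.support, (c k).r ≤ e := IsolatedBand.isolated_chain_forall_le hc2 hr0 k
  obtain ⟨ho, hpW, -⟩ := shadeTwo_letters p hc hr0 k
  obtain ⟨hck, -, -, -⟩ := corner_step hw hc hr0 hb k
  rw [hck] at hm'
  exact exists_source_of_corner (j k) (c k) rfl ho hr (by omega) hm'

/-- **Axis legality above the boundary**: for every letter `a` some `x^{r_k + m} ∈ supp F_k` has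
`(W_k − r_k(a)) + (|m| − m_a) ≤ p − 1`. [OURS · K2(p) phase d = 2] [folklore] -/
theorem exists_axis_witness
    (hc : ∀ k, IsIsolated p (c k).F ∧ Step0 p (c k) (c (k + 1)) ∧ ordZero (c k).F ≠ p ∧ (c k).shade = 2)
    (hr0 : ∀ e ∈ (c 0).F.support, (c 0).r ≤ e) (k : ℕ) (a : Fin 4) :
    ∃ m : Fin 4 →₀ ℕ, (c k).r + m ∈ (c k).F.support ∧ 2 ≤ m.degree ∧
      (c k).r.degree + m.degree < (c k).r a + m a + p := by
  have hc2 : ∀ k, IsIsolated p (c k).F ∧ Step0 p (c k) (c (k + 1)) := fun k => ⟨(hc k).1, (hc k).2.1⟩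
  have hr : ∀ e ∈ (c k).F.support, (c k).r ≤ e := IsolatedBand.isolated_chain_forall_le hc2 hr0 k
  obtain ⟨ho, -, -⟩ := shadeTwo_letters p hc hr0 k
  obtain ⟨e, he, hlt⟩ := exists_degree_lt_apply_add_of_isIsolated (hc k).1 a
  have hle : (c k).r ≤ e := hr e he
  obtain ⟨m, rfl⟩ : ∃ m, e = (c k).r + m := ⟨e - (c k).r, (add_tsub_cancel_of_le hle).symm⟩
  have hdeg : (c k).r.degree + 2 ≤ ((c k).r + m).degree := by
    by_contra hlt'
    exact (MvPolynomial.mem_support_iff.mp he) (((ordZero_eq_nat_iff _ _).mp ho).2 _ (by omega))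
  rw [map_add] at hdeg hlt
  rw [Finsupp.add_apply] at hlt
  exact ⟨m, he, by omega, by omega⟩


end Corner

end ResCone

end Summit.ResolutionOfSingularities.ResolutionOfSingularities.Theorems.PIDim4

end
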